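import Literature.AlgebraicGeometry.Motives.ProjectiveNoetherNormalization
import Literature.AlgebraicGeometry.Motives.FiniteProjectionExists
import HarnessLib

/-!
# Projective Noether normalisation of an embedded smooth projective variety, keeping track of `ψ^* H`

For a smooth projective variety `T` of dimension `n` over a field `k`, *given* with a closed
`k`-immersion `Ψ : T ↪ ℙᴷ_k`, there is a finite surjective `k`-morphism `ψ : T → ℙⁿ_k` whose
pulled-back hyperplane divisor `ψ^* H` is linearly equivalent to a *positive* multiple `m • D_Ψ` of
the hyperplane-section divisor `D_Ψ = div (Ψ^* x_{j₀})` of the embedding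
(`IsSmoothProjective.exists_isFinite_surjective_linEquiv_divisor_ofHom`, any field and dimension;
`IsSmoothProjective.exists_isFinite_surjective_hyperplane_pullback_linEquiv`, the complex
`(d + 1)`-dimensional form with the dominance witness of `ψ` exposed, as consumed by Chern-class
computations). This is Görtz–Wedhorn I, Thm. 13.89 together with the bookkeeping `ψ^* 𝒪(1) ≅ 𝓛^{⊗m}`,
`𝓛 = Ψ^* 𝒪(1)`, of its proof (Hartshorne I Thm. 7.2 ff. / II Ex. 4.1).

Assembly of tree results, exactly as in `Motives/FiniteProjectionExists` but for the *given*
embedding and without discarding the linear-equivalence clause: the generating sections `Ψ^* xⱼ`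
have affine non-vanishing loci `Ψ⁻¹ D₊(xⱼ)` (`GeneratingSections.ofHom`,
`GeneratingSections.isAffineOpen_ofHom_U`), so `D_Ψ` is ample (`GeneratingSections.isAmple_divisor`);
an ample divisor on an integral proper `k`-scheme yields, for `p = 2` and `n = n₀ + 1`, a finite
surjective `ψ : T → ℙ^{dim T}` with `ψ^* H ∼ ((n₀ + 1) 2ᶜ) • D_Ψ`
(`CartierDivisor.IsAmple.exists_finite_surjective_linEquiv`); finally `dim T = n`
(`schemeDim_eq_holds`), and a surjective morphism is dominant.

## References
* [GortzWedhorn2020] U. Görtz, T. Wedhorn, Algebraic Geometry I, 2nd ed. 2020, Thm. 13.89 (p. 519),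
  Prop. 13.47 (p. 493).
* [Hartshorne1977] R. Hartshorne, Algebraic Geometry, II Ex. 4.1, II Thm. 7.1.

#harness_tags algebraic_geometry.finite_morphisms, algebraic_geometry.projective_varieties
-/

noncomputable section

open CategoryTheory AlgebraicGeometry

universe u

namespace Literature.AlgebraicGeometry.Motives

/-- **Projective Noether normalisation with linear-equivalence control, any field.** For a smooth
projective variety `T` of dimension `n` over `k` with a closed `k`-immersion `Ψ : T ↪ ℙᴷ_k` and an
index `j₀` (with `Ψ⁻¹ D₊(x_{j₀}) ≠ ∅`), there are a finite surjective `k`-morphism `ψ : T → ℙⁿ_k` and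
`m > 0` with `ψ^* H ∼ m • div (Ψ^* x_{j₀})`. [cite: GortzWedhorn2020, Thm. 13.89 (p. 519)] -/
theorem IsSmoothProjective.exists_isFinite_surjective_linEquiv_divisor_ofHom {k : Type u} [Field k]
    {n K : ℕ} {T : SchemeOver k} [IsIntegral T.left] (hT : IsSmoothProjective n T)
    (Ψ : T ⟶ projectiveSpace K k) [hΨ : IsClosedImmersion Ψ.left] (j₀ : Fin (K + 1))
    (hj₀ : genericPoint T.left ∈ (GeneratingSections.ofHom Ψ.left).U j₀) :
    ∃ (ψ : T ⟶ projectiveSpace n k) (m : ℕ) (hψ : IsDominant ψ.left), 0 < m ∧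
      IsFinite ψ.left ∧ Surjective ψ.left ∧
      (@CartierDivisor.pullback _ _ (ProjSpace.hyperplane n k) T.left _ ψ.left hψ).LinEquiv
        (m • (GeneratingSections.ofHom Ψ.left).divisor j₀ hj₀) := by
  classical
  haveI : IsProper (T.left ↘ Spec (.of k)) := IsSmoothProjective.isProper_holds hT
  haveI : CompactSpace T.left := compactSpace_of_isProper k T.left
  haveI : QuasiSeparatedSpace T.left :=
    quasiSeparatedSpace_of_quasiSeparated (T.left ↘ Spec (.of k))
  -- the target of `Ψ.left` in the syntactic form `Proj K[x₀, …, x_K]` used by `GeneratingSections.ofHom`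
  haveI : IsClosedImmersion (Y := ProjSpace.P K k) Ψ.left := hΨ
  have hH : ((GeneratingSections.ofHom Ψ.left).divisor j₀ hj₀).IsAmple :=
    (GeneratingSections.ofHom Ψ.left).isAmple_divisor j₀ hj₀
      (GeneratingSections.isAffineOpen_ofHom_U Ψ.left)
  obtain ⟨n₀, hn₀⟩ := hH.exists_finite_surjective_linEquiv (K := k)
  obtain ⟨c, ψ, hψfin, hψsurj, hψover, hlin⟩ :=
    hn₀ 2 one_lt_two (n₀ + 1) (Nat.le_succ _) (Nat.succ_pos _)
  have hdim : schemeDim T.left = n := schemeDim_eq_holds hT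
  subst hdim
  exact ⟨Over.homMk ψ hψover, (n₀ + 1) * 2 ^ c, (show IsDominant ψ from inferInstance),
    Nat.mul_pos (Nat.succ_pos _) (Nat.pow_pos two_pos), hψfin, hψsurj, hlin⟩

/-- **Projective Noether normalisation with linear-equivalence control, complex `(d + 1)`-folds.**
For a smooth projective complex variety `T` of dimension `d + 1` with a closed immersion
`Ψ : T ↪ ℙᴷ`, there are a finite surjective (hence dominant) `ψ : T → ℙ^{d+1}` over `ℂ` and `m > 0`
with `ψ^* H ∼ m • div (Ψ^* x_{j₀})`; the dominance witness used to form `ψ^* H` is the one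
exhibited. [cite: GortzWedhorn2020, Thm. 13.89 (p. 519)] -/
theorem IsSmoothProjective.exists_isFinite_surjective_hyperplane_pullback_linEquiv :
    ∀ ⦃d K : ℕ⦄ ⦃T : SchemeOver ℂ⦄ [IsIntegral T.left] (hT : IsSmoothProjective (d + 1) T)
      (Ψ : T ⟶ projectiveSpace K ℂ) [IsClosedImmersion Ψ.left] (j₀ : Fin (K + 1))
      (hj₀ : genericPoint T.left ∈ (GeneratingSections.ofHom Ψ.left).U j₀),
      ∃ (ψ : T ⟶ projectiveSpace (d + 1) ℂ) (m : ℕ) (hψ : IsDominant ψ.left), 0 < m ∧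
        IsFinite ψ.left ∧ Surjective ψ.left ∧
        (@CartierDivisor.pullback _ _ (ProjSpace.hyperplane (d + 1) ℂ) T.left _ ψ.left hψ).LinEquiv
          (m • (GeneratingSections.ofHom Ψ.left).divisor j₀ hj₀) := by
  intro d K T _ hT Ψ _ j₀ hj₀
  exact hT.exists_isFinite_surjective_linEquiv_divisor_ofHom Ψ j₀ hj₀

end Literature.AlgebraicGeometry.Motives

end
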